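import Literature.MathematicalPhysics.QuantumLattice.HeisenbergRPSiteMonotonicity
import HarnessLib

/-!
# Reflection-positivity monotonicity along the axis with a two-site test vector

[LeesTaggi2021, Thm 4 and Lemma 7] prove monotonicity of the two-point function of the
reflection-positive quantum Heisenberg antiferromagnet along the odd axis sites from the Schwarz
inequality of reflection positivity (midpoint convexity) and the torus reflection symmetry; the tree
file `HeisenbergRPSiteMonotonicity` records the one-site version (`heisRedCorr2_oddAxis_antitone`).
The same two ingredients apply verbatim to any finitely supported test vector along the axis
([LeesTaggi2021, Lemma 7] is stated for arbitrary finitely supported functions); this file records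
the two-site vector `δ_j - δ_{j+1}` (alternating sign), i.e. the pair functional
`F(j) := -c(2j+1, 0) + 2 c(2j+2, 0) - c(2j+3, 0)` (`= m_{2j} + 2 m_{2j+1} + m_{2j+2}` in the moment
reading `m_s = (-1)^{s+1} c(s+1, 0)` of the reflection-positivity Gram/Hankel matrix), which is
non-negative (`heis_rpGram_sites`), midpoint convex in `j`, symmetric under `j ↦ k - 2 - j`, hence
non-increasing up to the middle: `F(j+1) ≤ F(j)` for `2j + 3 ≤ k`.

References: [cite: LeesTaggi2021, Thm 4, Lemma 7] (B. Lees, L. Taggi, *Site-monotonicity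
properties for reflection positive measures with applications to quantum spin systems*,
J. Stat. Phys. **183** (2021) 38, arXiv:2002.12666); [cite: DLS1978, Theorem 4.2]; [cite: KLS1988JSP, eq. (25)].
-/

noncomputable section

namespace Literature.MathematicalPhysics.QuantumLattice

open Finset Literature.Probability.LatticeModels

/-- **Non-negativity of the pair functional** `F(j) = -c(2j+1,0) + 2c(2j+2,0) - c(2j+3,0)`:
the reflection-positivity Gram form at the test vector `δ_{(j,0)} - δ_{(j+1,0)}`, `j + 1 < k`.
[cite: LeesTaggi2021, Lemma 7] [cite: DLS1978, Theorem 4.2] -/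
theorem heisRedCorr2_oddAxis_pairNonneg (k n : ℕ) [NeZero (2 * k)] {j : ℕ} (hj : j + 1 < k) :
    0 ≤ -heisRedCorr2 (2 * k) n (2 * j + 1) 0 + 2 * heisRedCorr2 (2 * k) n (2 * j + 2) 0 -
      heisRedCorr2 (2 * k) n (2 * j + 3) 0 := by
  have h := heis_rpGram_sites k n ![(j, 0), (j + 1, 0)]
    (fun i => by fin_cases i <;> simp <;> omega) ![1, -1]
  simp only [Fin.sum_univ_two, Matrix.cons_val_zero, Matrix.cons_val_one] at h
  have n1 : Int.natAbs (((0 : ℕ) : ℤ) - ((0 : ℕ) : ℤ)) = 0 := by simp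
  have e1 : j + j + 1 = 2 * j + 1 := by ring
  have e2 : j + (j + 1) + 1 = 2 * j + 2 := by ring
  have e3 : j + 1 + j + 1 = 2 * j + 2 := by ring
  have e4 : j + 1 + (j + 1) + 1 = 2 * j + 3 := by ring
  simp only [n1, e1, e2, e3, e4] at h
  norm_num at h ⊢; linarith

/-- **Midpoint convexity of the pair functional**: `2 F(j+1) ≤ F(j) + F(j+2)` for `j + 3 < k` —
the Gram form at the test table `δ_{(j,0)} - δ_{(j+1,0)} - δ_{(j+2,0)} + δ_{(j+3,0)}`.
[cite: LeesTaggi2021, Thm 4 (proof of Thm 1, §4), Lemma 7] [cite: KLS1988JSP, eq. (25)] -/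
theorem heisRedCorr2_oddAxis_pairMidpointConvex (k n : ℕ) [NeZero (2 * k)] {j : ℕ} (hj : j + 3 < k) :
    2 * (-heisRedCorr2 (2 * k) n (2 * j + 3) 0 + 2 * heisRedCorr2 (2 * k) n (2 * j + 4) 0 -
        heisRedCorr2 (2 * k) n (2 * j + 5) 0) ≤
      (-heisRedCorr2 (2 * k) n (2 * j + 1) 0 + 2 * heisRedCorr2 (2 * k) n (2 * j + 2) 0 -
        heisRedCorr2 (2 * k) n (2 * j + 3) 0) +
      (-heisRedCorr2 (2 * k) n (2 * j + 5) 0 + 2 * heisRedCorr2 (2 * k) n (2 * j + 6) 0 -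
        heisRedCorr2 (2 * k) n (2 * j + 7) 0) := by
  have h := heis_rpGram_sites k n ![(j, 0), (j + 1, 0), (j + 2, 0), (j + 3, 0)]
    (fun i => by fin_cases i <;> simp <;> omega) ![1, -1, -1, 1]
  simp only [Fin.sum_univ_four, Matrix.cons_val_zero, Matrix.cons_val_one, Matrix.head_cons,
    Matrix.cons_val_two, Matrix.cons_val_three, Matrix.tail_cons] at h
  have n1 : Int.natAbs (((0 : ℕ) : ℤ) - ((0 : ℕ) : ℤ)) = 0 := by simp
  have e1 : j + j + 1 = 2 * j + 1 := by ring
  have e2 : j + (j + 1) + 1 = 2 * j + 2 := by ring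
  have e3 : j + 1 + j + 1 = 2 * j + 2 := by ring
  have e4 : j + (j + 2) + 1 = 2 * j + 3 := by ring
  have e5 : j + 1 + (j + 1) + 1 = 2 * j + 3 := by ring
  have e6 : j + 2 + j + 1 = 2 * j + 3 := by ring
  have e7 : j + (j + 3) + 1 = 2 * j + 4 := by ring
  have e8 : j + 1 + (j + 2) + 1 = 2 * j + 4 := by ring
  have e9 : j + 2 + (j + 1) + 1 = 2 * j + 4 := by ring
  have e10 : j + 3 + j + 1 = 2 * j + 4 := by ring
  have e11 : j + 1 + (j + 3) + 1 = 2 * j + 5 := by ring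
  have e12 : j + 2 + (j + 2) + 1 = 2 * j + 5 := by ring
  have e13 : j + 3 + (j + 1) + 1 = 2 * j + 5 := by ring
  have e14 : j + 2 + (j + 3) + 1 = 2 * j + 6 := by ring
  have e15 : j + 3 + (j + 2) + 1 = 2 * j + 6 := by ring
  have e16 : j + 3 + (j + 3) + 1 = 2 * j + 7 := by ring
  simp only [n1, e1, e2, e3, e4, e5, e6, e7, e8, e9, e10, e11, e12, e13, e14, e15, e16] at h
  norm_num at h ⊢; linarith

/-- From midpoint convexity and a reflection symmetry to monotonicity (the contradiction chain of
[LeesTaggi2021, proof of Thm 1, §4]): a real sequence `f` on `0, …, J`, `J ≥ 1`, with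
non-decreasing increments and `f J = f 0` has `f 1 ≤ f 0`. [folklore] -/
private theorem pair_step_le_of_convex_of_symm (f : ℕ → ℝ) {J : ℕ} (hJ : 1 ≤ J)
    (hconv : ∀ j, j + 2 ≤ J → f (j + 1) - f j ≤ f (j + 2) - f (j + 1)) (hsym : f J = f 0) :
    f 1 ≤ f 0 := by
  by_contra hlt'
  have hlt : f 0 < f 1 := not_le.mp hlt'
  have hmono : ∀ j, j + 1 ≤ J → f 1 - f 0 ≤ f (j + 1) - f j := by
    intro j
    induction j with
    | zero => intro _; exact le_rfl
    | succ j ih =>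
      intro hj
      have h1 := ih (by omega)
      have h2 := hconv j (by omega)
      linarith
  have hsum : (J : ℝ) * (f 1 - f 0) ≤ ∑ j ∈ range J, (f (j + 1) - f j) :=
    calc (J : ℝ) * (f 1 - f 0) = ∑ j ∈ range J, (f 1 - f 0) := by
          rw [sum_const, card_range, nsmul_eq_mul]
      _ ≤ ∑ j ∈ range J, (f (j + 1) - f j) :=
          sum_le_sum fun j hj => hmono j (by have := mem_range.1 hj; omega)
  rw [sum_range_sub, hsym, sub_self] at hsum
  have hJ' : (1 : ℝ) ≤ J := by exact_mod_cast hJ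
  nlinarith

/-- **Pair monotonicity along the axis** ([LeesTaggi2021, Thm 4] with the two-site test vector):
on the torus of side `2k`, for `2j + 3 ≤ k`,
`-c(2j+3,0) + 2c(2j+4,0) - c(2j+5,0) ≤ -c(2j+1,0) + 2c(2j+2,0) - c(2j+3,0)`, i.e.
`m_{2j+2} + 2m_{2j+3} + m_{2j+4} ≤ m_{2j} + 2m_{2j+1} + m_{2j+2}` for the Hankel moments
`m_s = (-1)^{s+1} c(s+1, 0)` — midpoint convex (`heisRedCorr2_oddAxis_pairMidpointConvex`) and symmetric
under `j ↦ k - 2 - j` (`heisRedCorr2_two_mul_sub`), hence non-increasing up to the middle.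
[cite: LeesTaggi2021, Thm 4, Lemma 7] [cite: KLS1988JSP, eq. (25)] -/
theorem heisRedCorr2_oddAxis_pairAntitone (k n : ℕ) [NeZero (2 * k)] (j : ℕ) (hjk : 2 * j + 3 ≤ k) :
    -heisRedCorr2 (2 * k) n (2 * j + 3) 0 + 2 * heisRedCorr2 (2 * k) n (2 * j + 4) 0 -
        heisRedCorr2 (2 * k) n (2 * j + 5) 0 ≤
      -heisRedCorr2 (2 * k) n (2 * j + 1) 0 + 2 * heisRedCorr2 (2 * k) n (2 * j + 2) 0 -
        heisRedCorr2 (2 * k) n (2 * j + 3) 0 := by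
  -- the sequence `i ↦ F(j + i)` on `0, …, J` with `J = k - 2 - 2j`, `F(j + J) = F(k - 2 - j) = F(j)`
  set f : ℕ → ℝ := fun i => -heisRedCorr2 (2 * k) n (2 * j + 1 + 2 * i) 0 +
    2 * heisRedCorr2 (2 * k) n (2 * j + 2 + 2 * i) 0 - heisRedCorr2 (2 * k) n (2 * j + 3 + 2 * i) 0
    with hf
  have hJ : 1 ≤ k - 2 - 2 * j := by omega
  have hconv : ∀ i, i + 2 ≤ k - 2 - 2 * j → f (i + 1) - f i ≤ f (i + 2) - f (i + 1) := by
    intro i hi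
    have hc := heisRedCorr2_oddAxis_pairMidpointConvex k n (j := j + i) (by omega)
    have e1 : 2 * (j + i) + 1 = 2 * j + 1 + 2 * i := by ring
    have e2 : 2 * (j + i) + 2 = 2 * j + 2 + 2 * i := by ring
    have e3 : 2 * (j + i) + 3 = 2 * j + 3 + 2 * i := by ring
    have e3' : 2 * j + 3 + 2 * i = 2 * j + 1 + 2 * (i + 1) := by ring
    have e4 : 2 * (j + i) + 4 = 2 * j + 2 + 2 * (i + 1) := by ring
    have e5 : 2 * (j + i) + 5 = 2 * j + 3 + 2 * (i + 1) := by ring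
    have e5' : 2 * j + 3 + 2 * (i + 1) = 2 * j + 1 + 2 * (i + 2) := by ring
    have e6 : 2 * (j + i) + 6 = 2 * j + 2 + 2 * (i + 2) := by ring
    have e7 : 2 * (j + i) + 7 = 2 * j + 3 + 2 * (i + 2) := by ring
    rw [e1, e2, e3, e4, e5, e6, e7] at hc
    simp only [hf]
    rw [← e3', ← e5']
    linarith
  have hsym : f (k - 2 - 2 * j) = f 0 := by
    simp only [hf, Nat.mul_zero, Nat.add_zero]
    have e1 : 2 * j + 1 + 2 * (k - 2 - 2 * j) = 2 * k - (2 * j + 3) := by omega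
    have e2 : 2 * j + 2 + 2 * (k - 2 - 2 * j) = 2 * k - (2 * j + 2) := by omega
    have e3 : 2 * j + 3 + 2 * (k - 2 - 2 * j) = 2 * k - (2 * j + 1) := by omega
    rw [e1, e2, e3, heisRedCorr2_two_mul_sub k n (by omega) (by omega) 0,
      heisRedCorr2_two_mul_sub k n (by omega) (by omega) 0,
      heisRedCorr2_two_mul_sub k n (by omega) (by omega) 0]
    ring
  have h := pair_step_le_of_convex_of_symm f hJ hconv hsym
  have e1 : 2 * j + 1 + 2 * 1 = 2 * j + 3 := by ring
  have e2 : 2 * j + 2 + 2 * 1 = 2 * j + 4 := by ring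
  have e3 : 2 * j + 3 + 2 * 1 = 2 * j + 5 := by ring
  simp only [hf, Nat.mul_zero, Nat.add_zero, e1, e2, e3] at h
  exact h


end Literature.MathematicalPhysics.QuantumLattice

end
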